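import Mathlib
import Literature.RepresentationTheory.FiniteGroups.CharacterDegrees
import Literature.RepresentationTheory.FiniteGroups.IrreducibleCharacters
import Literature.RepresentationTheory.FiniteGroups.InducedClassFunction
import Literature.RepresentationTheory.FiniteGroups.BrauerInduction
import Literature.RepresentationTheory.FiniteGroups.RepresentationRing
import Summits.MatrixMultiplication.MatrixMultiplication.Theorems.LieRankDesigns.Negative.Basics
import Summits.MatrixMultiplication.MatrixMultiplication.Theorems.LevelGradedCohnUmansLieRankDesignsStubLevelOfFixedVector
import Summits.MatrixMultiplication.MatrixMultiplication.Theorems.SubgroupIdentityDesigns.Negative.ParabolicSubgroup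
import Summits.MatrixMultiplication.MatrixMultiplication.Theorems.SubgroupIdentityDesigns.Negative.ParabolicRestriction
import Summits.MatrixMultiplication.MatrixMultiplication.Theorems.SubgroupIdentityDesigns.Negative.ParabolicLevel
import Summits.MatrixMultiplication.MatrixMultiplication.Theorems.SubgroupIdentityDesigns.Negative.ParabolicIndex
import Summits.MatrixMultiplication.MatrixMultiplication.Theorems.SubgroupIdentityDesigns.Negative.SteinbergTower

/-!
# The hook unipotent character `χ^{(l,1^k)}` of `GL_{k+l}(𝔽_p)`: degree, level, irreducibility

Supports stmt-MatrixMultiplication-14079 (route `LevelGradedCohnUmans`, crux `SubgroupIdentityDesigns`).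
VALUE = theorem, NOT summit progress.  `hook k l = SteinbergTower.trunc (k+l) (k+1)
= Σ_{c ≤ k} (−1)^{k−c} I^{k+l}_c St_c`.

UNCONDITIONAL:
* `isIrrChar_of_mem_virtChars` — a virtual character `f ∈ R(G)` with `⟨f, f⟩ = 1` and `Re f(1) > 0` is an
  irreducible character (`f = Σ n_χ χ`, `Σ n_χ² = 1`);
* `steinberg_apply_one` — `St_a(1) = q^{a(a−1)/2}`; `trunc_apply_one` — `trunc N m (1) = q^{m(m−1)/2} [N−1, m−1]_q`
  (`ParabolicIndex.altSum_gauss` + `index_parab`); `hook_one`, `hook_one_ge` —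
  `hook(1) = q^{k(k+1)/2} [k+l−1, k]_q ≥ p^{kl} p^{k(k−1)/2}`, `hook_one_ne_zero`;
* `trunc_mem_levelSet`, `hook_mem_levelSet` — `hook k l ∈ F_k` (`ParabolicLevel.hcInd_mem_levelSet`).
CONDITIONAL on the maximal-parabolic Mackey formula (`SteinbergTower.MackeyFormula`, all `N' ≤ k + l`):
* `isIrrChar_hook` — `hook k l` is an irreducible character (`⟨hook, hook⟩ = 1`, `classInner_trunc_trunc`).
-/

set_option linter.dupNamespace false

noncomputable section

open scoped BigOperators Matrix Classical
open Literature.RepresentationTheory.FiniteGroups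
open Summit.MatrixMultiplication.MatrixMultiplication.Theorems.LieRankDesigns.Negative
  (GLm Mat fourierFn RankSupp levelSet re_apply_one_nonneg)
open Summit.MatrixMultiplication.MatrixMultiplication.Theorems.LieRankDesigns.LevelOfFixedVector
  (smul_mem_levelSet sum_mem_levelSet)

namespace Summit.MatrixMultiplication.MatrixMultiplication.Theorems.SubgroupIdentityDesigns.Negative
namespace HookCharacter

open ParabolicSubgroup ParabolicRestriction ParabolicLevel ParabolicIndex SteinbergTower

/-! ## Virtual characters of norm one -/

section NormOne

variable {G : Type} [Group G] [Fintype G]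

/-- **A virtual character of norm `1` and positive degree is an irreducible character.** -/
theorem isIrrChar_of_mem_virtChars {f : G → ℂ} (hf : f ∈ virtChars G) (h1 : classInner f f = 1)
    (hpos : 0 < (f 1).re) : IsIrrChar G f := by
  set S := (irrChars_finite_holds G).toFinset with hS
  have hmemS : ∀ {χ}, χ ∈ S → IsIrrChar G χ := fun {χ} hχ => by
    rw [hS, Set.Finite.mem_toFinset] at hχ
    exact hχ
  have hcf : IsClassFun f := isClassFun_of_mem_virtChars hf
  have hint : ∀ χ ∈ S, ∃ n : ℤ, classInner f χ = n := fun χ hχ =>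
    exists_int_classInner_of_mem_virtChars hf (hmemS hχ)
  choose! n hn using hint
  have hexp : f = ∑ χ ∈ S, classInner f χ • χ := hcf.eq_sum_classInner_smul
  -- `⟨f, f⟩ = Σ n_χ²`
  have hnorm : classInner f f = ∑ χ ∈ S, classInner f χ * classInner f χ := by
    have h0 : classInner f f = classInner (∑ χ ∈ S, classInner f χ • χ) f := by rw [← hexp]
    rw [h0, classInner_sum_left]
    exact Finset.sum_congr rfl fun χ _ => by rw [classInner_smul_left, classInner_comm]
  have hsum : ∑ χ ∈ S, n χ * n χ = 1 := by
    have h : ((∑ χ ∈ S, n χ * n χ : ℤ) : ℂ) = 1 := by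
      push_cast
      rw [← h1, hnorm]
      exact Finset.sum_congr rfl fun χ hχ => by rw [hn χ hχ]
    exact_mod_cast h
  -- exactly one nonzero coefficient, equal to `±1`
  obtain ⟨χ₀, hχ₀S, hχ₀⟩ : ∃ χ₀ ∈ S, n χ₀ ≠ 0 := by
    by_contra hcon
    push Not at hcon
    rw [Finset.sum_eq_zero (fun χ hχ => by rw [hcon χ hχ, mul_zero])] at hsum
    exact zero_ne_one hsum
  have hsplit := Finset.add_sum_erase S (fun χ => n χ * n χ) hχ₀S
  have hrest : 0 ≤ ∑ χ ∈ S.erase χ₀, n χ * n χ := Finset.sum_nonneg fun χ _ => mul_self_nonneg _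
  have hsq : 0 < n χ₀ * n χ₀ := mul_self_pos.mpr hχ₀
  have hone : n χ₀ * n χ₀ = 1 := by linarith
  have hzero : ∀ χ ∈ S, χ ≠ χ₀ → n χ = 0 := by
    intro χ hχ hne
    have h0 : ∑ χ ∈ S.erase χ₀, n χ * n χ = 0 := by linarith
    exact mul_self_eq_zero.mp ((Finset.sum_eq_zero_iff_of_nonneg fun χ _ => mul_self_nonneg _).mp h0 χ
      (Finset.mem_erase.mpr ⟨hne, hχ⟩))
  have hf0 : f = (n χ₀ : ℂ) • χ₀ := by
    rw [hexp, Finset.sum_eq_single χ₀ (fun χ hχ hne => by rw [hn χ hχ, hzero χ hχ hne]; simp)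
      (fun h => absurd hχ₀S h), hn χ₀ hχ₀S]
  rcases Int.eq_one_or_neg_one_of_mul_eq_one hone with h | h
  · rw [h, Int.cast_one, one_smul] at hf0
    rw [hf0]
    exact hmemS hχ₀S
  · exfalso
    have hre : (f 1).re = -(χ₀ 1).re := by
      rw [hf0, h, Pi.smul_apply, smul_eq_mul]
      simp
    have := re_apply_one_nonneg (χ := χ₀) (hmemS hχ₀S)
    linarith

end NormOne

/-! ## Degrees of the Steinberg tower -/

section Degrees

variable {F : Type} [Field F] [Fintype F] [DecidableEq F]

/-- **`St_a(1) = q^{a(a−1)/2}`** (exponent written `Σ_{i<a} i`). -/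
theorem steinberg_apply_one (a : ℕ) :
    (steinberg a : GL (Fin a) F → ℂ) 1 = ((Fintype.card F ^ (∑ i ∈ Finset.range a, i) : ℕ) : ℂ) := by
  induction a using Nat.strong_induction_on with
  | _ a ih =>
    rcases a with _ | a
    · rw [steinberg_zero]; simp
    · rw [steinberg_succ, trunc, Finset.sum_apply]
      have hterm : ∀ c : Fin (a + 1),
          ((-1 : ℂ) ^ (a + 1 - 1 - (c : ℕ)) • hcInd ((le_of_lt c.2).trans le_rfl) (steinberg (F := F) c)) 1 =
            (-1 : ℂ) ^ (a - (c : ℕ)) * ((gauss (Fintype.card F) (a + 1) c *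
              Fintype.card F ^ (∑ i ∈ Finset.range c, i) : ℕ) : ℂ) := by
        intro c
        rw [Pi.smul_apply, smul_eq_mul, hcInd_apply_one, card_quotient_parab (le_of_lt c.2), ih c c.2,
          Nat.add_sub_cancel]
        push_cast
        ring
      rw [Finset.sum_congr rfl fun c _ => hterm c,
        Fin.sum_univ_eq_sum_range (fun c => (-1 : ℂ) ^ (a - c) *
          ((gauss (Fintype.card F) (a + 1) c * Fintype.card F ^ (∑ i ∈ Finset.range c, i) : ℕ) : ℂ)) (a + 1),
        altSum_gauss (Fintype.card F) (by omega) a, Nat.add_sub_cancel, gauss_self, mul_one]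

/-- **`trunc N m (1) = q^{Σ_{i<m} i} [N−1, m−1]_q`** for `1 ≤ m ≤ N`. -/
theorem trunc_apply_one {N m : ℕ} (hm : m ≤ N) (h1 : 1 ≤ m) :
    trunc (F := F) N m hm 1 =
      ((Fintype.card F ^ (∑ i ∈ Finset.range m, i) * gauss (Fintype.card F) (N - 1) (m - 1) : ℕ) : ℂ) := by
  rw [trunc, Finset.sum_apply]
  have hterm : ∀ c : Fin m,
      ((-1 : ℂ) ^ (m - 1 - (c : ℕ)) • hcInd ((le_of_lt c.2).trans hm) (steinberg (F := F) c)) 1 =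
        (-1 : ℂ) ^ (m - 1 - (c : ℕ)) * ((gauss (Fintype.card F) N c *
          Fintype.card F ^ (∑ i ∈ Finset.range c, i) : ℕ) : ℂ) := by
    intro c
    rw [Pi.smul_apply, smul_eq_mul, hcInd_apply_one, card_quotient_parab ((le_of_lt c.2).trans hm),
      steinberg_apply_one]
    push_cast
    ring
  obtain ⟨m, rfl⟩ : ∃ m', m = m' + 1 := ⟨m - 1, by omega⟩
  rw [Finset.sum_congr rfl fun c _ => hterm c,
    Fin.sum_univ_eq_sum_range (fun c => (-1 : ℂ) ^ (m + 1 - 1 - c) *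
      ((gauss (Fintype.card F) N c * Fintype.card F ^ (∑ i ∈ Finset.range c, i) : ℕ) : ℂ)) (m + 1),
    Nat.add_sub_cancel, altSum_gauss (Fintype.card F) (by omega) m]

end Degrees

/-! ## The hook character over `𝔽_p` -/

variable {p : ℕ} [hp : Fact p.Prime] {k l : ℕ}

/-- **The hook character** `χ^{(l,1^k)} = Σ_{c ≤ k} (−1)^{k−c} I^{k+l}_c St_c` of `GL_{k+l}(𝔽_p)` (`l ≥ 1`). -/
def hook (k l : ℕ) (hl : 1 ≤ l) : GLm p (k + l) → ℂ := trunc (k + l) (k + 1) (by omega)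

/-- `hook(1) = p^{Σ_{i ≤ k} i} [k+l−1, k]_p`. -/
theorem hook_one (hl : 1 ≤ l) :
    hook (p := p) k l hl 1 = ((p ^ (∑ i ∈ Finset.range (k + 1), i) * gauss p (k + l - 1) k : ℕ) : ℂ) := by
  rw [hook, trunc_apply_one _ (by omega), ZMod.card, Nat.add_sub_cancel]

/-- **`hook(1) ≥ p^{kl} · p^{k(k−1)/2}`** (the threshold degree of `FlagNoGo`, cf. `FlagTwistNoGo`). -/
theorem hook_one_ge (hl : 1 ≤ l) :
    (((p ^ (k * l) * p ^ (∑ i ∈ Finset.range k, i) : ℕ) : ℝ)) ≤ (hook (p := p) k l hl 1).re := by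
  rw [hook_one]
  have h : p ^ (k * l) * p ^ (∑ i ∈ Finset.range k, i) ≤
      p ^ (∑ i ∈ Finset.range (k + 1), i) * gauss p (k + l - 1) k := by
    calc p ^ (k * l) * p ^ (∑ i ∈ Finset.range k, i)
        = p ^ (∑ i ∈ Finset.range (k + 1), i) * p ^ (k * (k + l - 1 - k)) := by
          rw [← pow_add, ← pow_add, Finset.sum_range_succ]
          congr 1
          rw [show k + l - 1 - k = l - 1 by omega]
          obtain ⟨l', rfl⟩ : ∃ l', l = l' + 1 := ⟨l - 1, by omega⟩
          rw [Nat.add_sub_cancel]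
          ring
      _ ≤ _ := Nat.mul_le_mul_left _ (pow_le_gauss hp.out.one_lt.le (by omega))
  exact_mod_cast h

/-- `hook(1) ≠ 0`. -/
theorem hook_one_ne_zero (hl : 1 ≤ l) : hook (p := p) k l hl 1 ≠ 0 := by
  rw [hook_one, Nat.cast_ne_zero]
  exact Nat.mul_ne_zero (pow_ne_zero _ hp.out.ne_zero)
    (Nat.pos_iff_ne_zero.mp (lt_of_lt_of_le (pow_pos hp.out.pos _)
      (pow_le_gauss hp.out.one_lt.le (by omega))))

/-- `Re hook(1) > 0`. -/
theorem hook_one_re_pos (hl : 1 ≤ l) : 0 < (hook (p := p) k l hl 1).re := by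
  have h1 : (1 : ℝ) ≤ ((p ^ (k * l) * p ^ (∑ i ∈ Finset.range k, i) : ℕ) : ℝ) := by
    exact_mod_cast Nat.mul_pos (pow_pos hp.out.pos _) (pow_pos hp.out.pos _)
  exact lt_of_lt_of_le (lt_of_lt_of_le one_pos h1) (hook_one_ge hl)

/-- **`trunc N m ∈ F_k`** whenever `m ≤ k + 1` (each `I^N_c St_c`, `c < m`, has level `c ≤ k`). -/
theorem trunc_mem_levelSet {N m : ℕ} (hm : m ≤ N) {k : ℕ} (hk : m ≤ k + 1) :
    trunc (F := ZMod p) N m hm ∈ levelSet p N k := by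
  have h : trunc (F := ZMod p) N m hm = fun g => ∑ c : Fin m,
      ((-1 : ℂ) ^ (m - 1 - (c : ℕ)) • hcInd ((le_of_lt c.2).trans hm) (steinberg c)) g := by
    funext g; rw [trunc, Finset.sum_apply]
  rw [h]
  refine sum_mem_levelSet _ _ fun c _ => ?_
  have h' : ((-1 : ℂ) ^ (m - 1 - (c : ℕ)) • hcInd (F := ZMod p) ((le_of_lt c.2).trans hm) (steinberg c)) =
      fun g => (-1 : ℂ) ^ (m - 1 - (c : ℕ)) * hcInd ((le_of_lt c.2).trans hm) (steinberg c) g := by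
    funext g; rw [Pi.smul_apply, smul_eq_mul]
  rw [h']
  exact smul_mem_levelSet (hcInd_mem_levelSet _ _ (by omega)) _

/-- **`hook k l ∈ F_k`.** -/
theorem hook_mem_levelSet (hl : 1 ≤ l) : hook (p := p) k l hl ∈ levelSet p (k + l) k :=
  trunc_mem_levelSet _ le_rfl

/-- `⟨hook, hook⟩ = 1`, CONDITIONAL on the Mackey formula for all `N' ≤ k + l`. -/
theorem classInner_hook_hook (hM : ∀ N', N' ≤ k + l → MackeyFormula (ZMod p) N') (hl : 1 ≤ l) :
    classInner (hook (p := p) k l hl) (hook k l hl) = 1 :=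
  classInner_trunc_trunc hM _ (by omega)

/-- **The hook character is an irreducible character**, CONDITIONAL on the Mackey formula. -/
theorem isIrrChar_hook (hM : ∀ N', N' ≤ k + l → MackeyFormula (ZMod p) N') (hl : 1 ≤ l) :
    IsIrrChar (GLm p (k + l)) (hook (p := p) k l hl) :=
  isIrrChar_of_mem_virtChars (trunc_mem_virtChars _) (classInner_hook_hook hM hl) (hook_one_re_pos hl)

/-- Hence `hook k l ∈ Irr(GL_{k+l}(𝔽_p)) ∩ F_k`, CONDITIONAL on the Mackey formula. -/
theorem hook_mem_irrChars_inter_levelSet (hM : ∀ N', N' ≤ k + l → MackeyFormula (ZMod p) N')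
    (hl : 1 ≤ l) : hook (p := p) k l hl ∈ irrChars (GLm p (k + l)) ∩ levelSet p (k + l) k :=
  ⟨isIrrChar_hook hM hl, hook_mem_levelSet hl⟩

end HookCharacter
end Summit.MatrixMultiplication.MatrixMultiplication.Theorems.SubgroupIdentityDesigns.Negative
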